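import Summits.ResolutionOfSingularities.ResolutionOfSingularities.Theorems.FrobeniusClosingPatchingRelPerfectMonomialGameMove
import Summits.ResolutionOfSingularities.ResolutionOfSingularities.Theorems.FrobeniusClosingPatchingRelPerfectMonomialPolyhedraGameMarked
import HarnessLib

/-!
# Crux `PatchingRelPerfect` (stmt-ResolutionOfSingularities-16161), chain w52 — M2-strong, SCHEME DICTIONARY
# part 4m: one game MOVE WITH MARKING `m` on the scheme side, and the point/clique weight dictionary

[OURS · L1 W5.2 · TargetsF3 (m) M2-strong, background line; Route K step K4 support, answering
res-type-075's reuse question 2026-08-27T08:24:01Z] Sequel of `…MonomialGameMove.lean` (the `c = 0` step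
`gameInv_move`).  Route K (res-type-075) reads Kollár's functorial order reduction of the realised monomial
triple back as moves of the MARKED game (`PolyhedraGame.move s J e m`, controlled transform with marking `m`,
`WinnableAll m` / `RouteKTarget m` of `…MonomialPolyhedraGameMarked.lean`).  PROVED here, for every marking `m`:

* **`agree_move_marked`** — the transformed member `transformExp A π T m` agrees with the moved game vector
  `moveExp J e m α` at every pointed position (both sides subtract `m` from the same weight:
  `weightOf_image_nthSheaf_eq_sum`);
* **`gameInv_move_marked`** — the invariant `GameInv` holds between `move s J e m` and the blown-up datum
  `(X′, Es.map strict ++ [F], 𝒦.map (transformExp · π T m), labMove)` for ANY blow-up `π` of the stratum of the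
  positions of `J` (hypothesis only `J ⊆ s.B`; permissibility is not needed for the bookkeeping), with the
  wrapper `gameInv_move_of_permissibleM`;
* the CLIQUE DICTIONARY at a point (S = the positions whose divisor passes through `x`):
  `GameInv.image_lab_mem_str` (its label image is a game stratum) and
  **`GameInv.weight_image_lab_eq_weightAt`**: for a member `A` agreeing with a game vector `α`, the game weight
  of `α` on that stratum is the scheme weight `weightAt A x` (the order of the monomial `Π E^{A}` at `x`) — the
  input of the «won»/«permissible» read-outs of Route K (`WonM m`, `PermissibleM m`).

Fact-free, any scheme (`IsLocallyNoetherian` for the move), any dimension; nothing here is a statement of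
the manuscript under review.

## References

* J. Kollár, *Lectures on Resolution of Singularities* (2007), (3.111) Step 3. [Kollar2007]
-/

-- `Summit.<Summit>.<Sub>.Theorems` with `Sub = Summit` (single-conjunct summit, D-0017)
set_option linter.dupNamespace false

noncomputable section

open CategoryTheory AlgebraicGeometry TopologicalSpace IsLocalRing
open Literature.AlgebraicGeometry.Resolution

namespace Summit.ResolutionOfSingularities.ResolutionOfSingularities.Theorems

namespace MonomialCleanup

open DepthTargets (monomialSum monomialSum_nil monomialSum_cons)
open PolyhedraGame (State Winnable Permissible PermissibleM Principal PrincipalAt moveExp moveStrata move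
  weight GlobalPermissiblePolyhedraGame mem_moveStrata_iff moveExp_apply_of_ne moveExp_apply_self)

universe u

/-! ## The marked step: the invariant at the moved state `move s J e m` -/

section MoveMarked

variable {X X' : Scheme.{u}} [IsLocallyNoetherian X] {s : State} {Es : List X.IdealSheafData}
  {𝒦 : List (List (X.IdealSheafData × ℕ))} {lab : ℕ → ℕ} {J : Finset ℕ} {e m : ℕ} {π : X' ⟶ X}

open Classical in
omit [IsLocallyNoetherian X] in
/-- **Agreement persists under the marked move**: the transformed member `transformExp A π T m` agrees with
the moved game vector `moveExp J e m α` at every pointed position of the transformed boundary — at the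
exceptional position both carry `|α_J| − m` (`weightOf_image_nthSheaf_eq_sum`). [cite: Kollar2007, (3.111) Step 3] -/
theorem agree_move_marked (hinv : GameInv s Es 𝒦 lab) (hJB : J ⊆ s.B) (he : e ∉ s.B)
    {A : List (X.IdealSheafData × ℕ)} {α : ℕ →₀ ℕ} (hA : A ∈ 𝒦) (hα : α ∈ s.A) (hagr : Agree Es lab A α) :
    Agree (Es.map (strictTransformIdeal π (((posOf Es lab J).image (nthSheaf Es)).sup id)) ++
        [(((posOf Es lab J).image (nthSheaf Es)).sup id).comap π])
      (labMove Es lab e) (transformExp A π ((posOf Es lab J).image (nthSheaf Es)) m) (moveExp J e m α) := by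
  set P := posOf Es lab J with hPdef
  set T := P.image (nthSheaf Es) with hTdef
  have hPlt : ∀ k ∈ P, k < Es.length := fun k hk => (mem_posOf_iff.mp hk).1
  have hlenA : A.length = Es.length := hinv.length_eq hA
  intro k hk hptd
  have hlen' : (Es.map (strictTransformIdeal π (T.sup id)) ++ [(T.sup id).comap π]).length = Es.length + 1 := by
    simp
  rw [hlen'] at hk
  obtain ⟨x', hx'⟩ := hptd
  rcases Nat.lt_succ_iff_lt_or_eq.mp hk with hk | rfl
  · -- an old position
    have hne : lab k ≠ e := fun h => he (h ▸ hinv.lab_mem hk)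
    rw [nthSheaf_transformBoundary_lt Es hk] at hx'
    rw [labMove_lt hk, moveExp_apply_of_ne α hne, nthExp_transformExp_lt A (hlenA ▸ hk),
      hagr k hk ⟨π x', mem_support_of_mem_support_strictTransformIdeal hx'⟩]
  · -- the exceptional position
    rw [nthSheaf_transformBoundary_eq Es] at hx'
    have hx'' : x' ∈ (((T.sup id).comap π).support : Set X') := hx'
    rw [Scheme.IdealSheafData.support_comap] at hx''
    have hPx : ∀ k ∈ P, π x' ∈ (nthSheaf Es k).support := fun k hk =>
      (mem_support_finsetSup_iff T _).mp hx'' _ (Finset.mem_image_of_mem _ hk)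
    have heα : e ∉ α.support := fun h => he (hinv.supp α hα e (Finsupp.mem_support_iff.mp h))
    rw [labMove_length, moveExp_apply_self α heα, ← hlenA, nthExp_transformExp_eq A,
      weight_eq_sum_posOf hinv hJB]
    -- `Σ_{k∈P} α (lab k) = weightOf A T`
    have hPD : PointedDistinct (boundaryOf A) := (hinv.bd A hA).symm ▸ hinv.pd
    have hPltA : ∀ k ∈ P, k < A.length := fun k hk => hlenA ▸ hPlt k hk
    have hPxA : ∀ k ∈ P, π x' ∈ (nthSheaf (boundaryOf A) k).support := fun k hk => by
      rw [hinv.bd A hA]; exact hPx k hk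
    have hw := weightOf_image_nthSheaf_eq_sum hPD hPltA hPxA
    rw [hinv.bd A hA] at hw
    rw [← hPdef, hw]
    congr 1
    exact Finset.sum_congr rfl fun k hk => hagr k (hPlt k hk) ⟨π x', hPx k hk⟩

open Classical in
/-- **The invariant at the moved state, marking `m`**: blowing up the stratum of the positions of `J`
(`J ⊆ s.B`; any blow-up `π` of it) and transforming every member by `transformExp · π T m` realises
`PolyhedraGame.move s J e m` for every fresh index `e`. [cite: Kollar2007, (3.111) Step 3] -/
theorem gameInv_move_marked (hinv : GameInv s Es 𝒦 lab) (hJB : J ⊆ s.B) (he : e ∉ s.B)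
    (hπ : IsBlowup π (((posOf Es lab J).image (nthSheaf Es)).sup id)) :
    GameInv (move s J e m)
      (Es.map (strictTransformIdeal π (((posOf Es lab J).image (nthSheaf Es)).sup id)) ++
        [(((posOf Es lab J).image (nthSheaf Es)).sup id).comap π])
      (𝒦.map fun A => transformExp A π ((posOf Es lab J).image (nthSheaf Es)) m) (labMove Es lab e) := by
  set P := posOf Es lab J with hPdef
  set T := P.image (nthSheaf Es) with hTdef
  have hPlt : ∀ k ∈ P, k < Es.length := fun k hk => (mem_posOf_iff.mp hk).1
  have hT : ∀ K ∈ T, K ∈ Es := image_nthSheaf_subset hPlt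
  have hlen' : (Es.map (strictTransformIdeal π (T.sup id)) ++ [(T.sup id).comap π]).length = Es.length + 1 := by
    simp
  have hsnc : HasSNC (Es.map (strictTransformIdeal π (T.sup id)) ++ [(T.sup id).comap π]) :=
    (hinv.snc.hasSNCWith_finsetSup T hT).hasSNC_transform hπ
  have hbd : ∀ A' ∈ 𝒦.map (fun A => transformExp A π T m),
      boundaryOf A' = Es.map (strictTransformIdeal π (T.sup id)) ++ [(T.sup id).comap π] := by
    intro A' hA'
    obtain ⟨A, hA, rfl⟩ := List.mem_map.mp hA'
    rw [boundaryOf_transformExp, hinv.bd A hA]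
  have hpd := hinv.pd.transformBoundary hinv.snc hT hπ
  have hlabinj : ∀ k k', k < Es.length + 1 → k' < Es.length + 1 →
      labMove Es lab e k = labMove Es lab e k' → k = k' := by
    intro k k' hk hk' h
    rcases Nat.lt_succ_iff_lt_or_eq.mp hk with hk | rfl
    · rcases Nat.lt_succ_iff_lt_or_eq.mp hk' with hk' | rfl
      · rw [labMove_lt hk, labMove_lt hk'] at h; exact hinv.lab_inj k k' hk hk' h
      · rw [labMove_lt hk, labMove_length] at h
        exact absurd (h ▸ hinv.lab_mem hk) he
    · rcases Nat.lt_succ_iff_lt_or_eq.mp hk' with hk' | hk'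
      · rw [labMove_length, labMove_lt hk'] at h
        exact absurd (h.symm ▸ hinv.lab_mem hk') he
      · exact hk'.symm
  have hBeq : (move s J e m).B = (Finset.range (Es.length + 1)).image (labMove Es lab e) := by
    show insert e s.B = _
    rw [Finset.range_add_one, Finset.image_insert, labMove_length, hinv.B_eq]
    congr 1
    exact Finset.image_congr fun k hk => (labMove_lt (Finset.mem_range.mp (Finset.mem_coe.mp hk))).symm
  have hstrB : ∀ T' ∈ (move s J e m).Str, T' ⊆ (move s J e m).B := by
    intro T' hT'
    show T' ⊆ insert e s.B
    rcases mem_moveStrata_iff.mp hT' with ⟨h1, -⟩ | ⟨T₀, h₀, -, -, rfl⟩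
    · exact (hinv.str_B T' h1).trans (Finset.subset_insert _ _)
    · exact Finset.insert_subset_insert _ (hinv.str_B T₀ h₀)
  have hsupp : ∀ α' ∈ (move s J e m).A, ∀ b, α' b ≠ 0 → b ∈ (move s J e m).B := by
    intro α' hα' b hb
    show b ∈ insert e s.B
    obtain ⟨α, hα, rfl⟩ := Finset.mem_image.mp hα'
    by_cases hbe : b = e
    · subst hbe; exact Finset.mem_insert_self _ _
    · rw [moveExp_apply_of_ne α hbe] at hb
      exact Finset.mem_insert_of_mem (hinv.supp α hα b hb)
  refine ⟨hsnc, hbd, hpd, fun k k' hk hk' => hlabinj k k' (hlen' ▸ hk) (hlen' ▸ hk'), hlen'.symm ▸ hBeq,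
    hstrB, hsupp, fun S' hS'lt hS'pt => ?_, fun A' hA' => ?_, fun α' hα' => ?_⟩
  · obtain ⟨x', hx'⟩ := hS'pt
    exact str_move hinv hJB hπ S' (fun k hk => hlen' ▸ hS'lt k hk) hx'
  · obtain ⟨A, hA, rfl⟩ := List.mem_map.mp hA'
    obtain ⟨α, hα, hagr⟩ := hinv.fwd A hA
    exact ⟨moveExp J e m α, Finset.mem_image_of_mem _ hα, agree_move_marked hinv hJB he hA hα hagr⟩
  · obtain ⟨α, hα, rfl⟩ := Finset.mem_image.mp hα'
    obtain ⟨A, hA, hagr⟩ := hinv.bwd α hα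
    exact ⟨transformExp A π T m, List.mem_map.mpr ⟨A, hA, rfl⟩, agree_move_marked hinv hJB he hA hα hagr⟩

open Classical in
/-- **The invariant after a move that is permissible for the marking `m`** (`PolyhedraGame.PermissibleM`):
the form consumed by an induction on `PolyhedraGame.WinnableAll m`. [cite: Kollar2007, (3.111) Step 3] -/
theorem gameInv_move_of_permissibleM (hinv : GameInv s Es 𝒦 lab) (hJ : PermissibleM m s J) (he : e ∉ s.B)
    (hπ : IsBlowup π (((posOf Es lab J).image (nthSheaf Es)).sup id)) :
    GameInv (move s J e m)
      (Es.map (strictTransformIdeal π (((posOf Es lab J).image (nthSheaf Es)).sup id)) ++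
        [(((posOf Es lab J).image (nthSheaf Es)).sup id).comap π])
      (𝒦.map fun A => transformExp A π ((posOf Es lab J).image (nthSheaf Es)) m) (labMove Es lab e) :=
  gameInv_move_marked hinv (hinv.str_B J hJ.1) he hπ

end MoveMarked

/-! ## The clique of a point and its weights -/

section Clique

variable {X : Scheme.{u}} {s : State} {Es : List X.IdealSheafData}
  {𝒦 : List (List (X.IdealSheafData × ℕ))} {lab : ℕ → ℕ}

/-- **The label image of a set of positions with a common point is a game stratum** (in particular the
position clique of a point `x`: the positions `k < Es.length` with `x ∈ supp Es[k]`). [folklore] -/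
theorem GameInv.image_lab_mem_str (hinv : GameInv s Es 𝒦 lab) {S : Finset ℕ} {x : X}
    (hS : ∀ k ∈ S, k < Es.length ∧ x ∈ (nthSheaf Es k).support) : S.image lab ∈ s.Str :=
  hinv.str S (fun k hk => (hS k hk).1) ⟨x, fun k hk => (hS k hk).2⟩

open Classical in
/-- The game weight of a vector on the label image of a set of positions is the sum of its values at the
labels of those positions (the labelling is injective on positions). [folklore] -/
theorem GameInv.weight_image_lab_eq_sum (hinv : GameInv s Es 𝒦 lab) {S : Finset ℕ}
    (hS : ∀ k ∈ S, k < Es.length) (α : ℕ →₀ ℕ) :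
    weight (S.image lab) α = ∑ k ∈ S, α (lab k) := by
  rw [weight, Finset.sum_image]
  intro k hk k' hk' h
  exact hinv.lab_inj k k' (hS k (Finset.mem_coe.mp hk)) (hS k' (Finset.mem_coe.mp hk')) h

open Classical in
/-- **Point/clique weight dictionary**: for a member `A` agreeing with the game vector `α` and `S` the
position clique of `x` (ALL positions whose divisor passes through `x`), the game weight of `α` on the stratum
`S.image lab` is the scheme weight of `A` at `x` (the order at `x` of the monomial `Π_K K^{A_K}` on a simple
normal crossings boundary). [folklore] -/
theorem GameInv.weight_image_lab_eq_weightAt (hinv : GameInv s Es 𝒦 lab) {A : List (X.IdealSheafData × ℕ)}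
    {α : ℕ →₀ ℕ} (hA : A ∈ 𝒦) (hagr : Agree Es lab A α) {x : X} {S : Finset ℕ}
    (hS : ∀ k, k ∈ S ↔ k < Es.length ∧ x ∈ (nthSheaf Es k).support) :
    weight (S.image lab) α = weightAt A x := by
  have hlenA : A.length = Es.length := hinv.length_eq hA
  have hSeq : S = (Finset.range Es.length).filter fun k => x ∈ (nthSheaf Es k).support := by
    ext k
    rw [hS k, Finset.mem_filter, Finset.mem_range]
  rw [hinv.weight_image_lab_eq_sum (fun k hk => ((hS k).mp hk).1), weightAt_eq_sum_nthExp,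
    ← Finset.sum_filter, hinv.bd A hA, hlenA, hSeq]
  refine Finset.sum_congr rfl fun k hk => ?_
  obtain ⟨hk, hx⟩ := Finset.mem_filter.mp hk
  exact hagr k (Finset.mem_range.mp hk) ⟨x, hx⟩

/-- **Every game vector's weight on the stratum of `x` is the weight at `x` of some member** — the read-out
Route K needs for `PolyhedraGame.WonM m` («at a point of every stratum some member has order `< m`») and,
conversely (`GameInv.exists_vector_weight_eq`), for `PolyhedraGame.PermissibleM m` («every member has order
`≥ m` along the centre»). [folklore] -/
theorem GameInv.exists_member_weightAt_eq (hinv : GameInv s Es 𝒦 lab) {α : ℕ →₀ ℕ} (hα : α ∈ s.A) {x : X}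
    {S : Finset ℕ} (hS : ∀ k, k ∈ S ↔ k < Es.length ∧ x ∈ (nthSheaf Es k).support) :
    ∃ A ∈ 𝒦, weightAt A x = weight (S.image lab) α := by
  obtain ⟨A, hA, hagr⟩ := hinv.bwd α hα
  exact ⟨A, hA, (hinv.weight_image_lab_eq_weightAt hA hagr hS).symm⟩

/-- Converse read-out: every member's weight at `x` is the weight of some game vector on the stratum of
`x`. [folklore] -/
theorem GameInv.exists_vector_weight_eq (hinv : GameInv s Es 𝒦 lab) {A : List (X.IdealSheafData × ℕ)}
    (hA : A ∈ 𝒦) {x : X} {S : Finset ℕ} (hS : ∀ k, k ∈ S ↔ k < Es.length ∧ x ∈ (nthSheaf Es k).support) :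
    ∃ α ∈ s.A, weight (S.image lab) α = weightAt A x := by
  obtain ⟨α, hα, hagr⟩ := hinv.fwd A hA
  exact ⟨α, hα, hinv.weight_image_lab_eq_weightAt hA hagr hS⟩

end Clique

end MonomialCleanup

end Summit.ResolutionOfSingularities.ResolutionOfSingularities.Theorems

end
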